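import Mathlib
import Summits.Ventures.HodgeRepro.Tier4.Line4.TorusFinSplit
import Summits.Ventures.HodgeRepro.Tier4.Line4.CentreFinDomain
import Summits.Ventures.HodgeRepro.Tier4.Line4.TransporterLocal
import Summits.Ventures.HodgeRepro.Tier4.Line4.LevelSplit

/-!
# Tier4/Line4/ZDomainSplit — a fundamental domain for the rational centre in PRODUCT form along the `S`-split:
`T_S × DZ^{(S)}` (C-L4-PSPLIT, Part B.3′ = ZDOMAIN-EX (iv) in the product form)

Blind re-derivation cell `pub-hodge-repro`, Tier 4 «prove the step» (README §9–§10), seat t4-L2-p1 (gen 3; plan-4 g6 S15687: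
«ZDOMAIN-EX (iv) in the product form `DZf = torusFinSplit⁻¹(DZS ×ˢ DZA)` is yours»; L2-p2 g5 S15678 yields it).  Tree path
`lean/Summits/Ventures/HodgeRepro/Tier4/Line4/ZDomainSplit.lean`.  Imports `Line4/TorusFinSplit` (the split), `Line4/CentreFinDomain` (L2-p2's `centreFin`, the pattern `IsFundamentalDomain.preimage_of_equiv` of
`isFundamentalDomain_prodDomain`).  Two definitions (`awayTfHom`, `centreAway`); no literature.

THE SHAPE.  The rational centre `centreFin W ≤ T_f` acts on `T_f = T_S × T_f^{(S)}` diagonally, `z ↦ (z_S, z^{(S)})`.  If the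
away part `z ↦ z^{(S)}` is INJECTIVE on `centreFin W` (`hinj`; true as soon as one place off `S` sees the rational centre
faithfully — a root of unity `≠ 1` is `≠ 1` in every completion — to be discharged by the owner of `centreFin`'s structure),
then for a fundamental domain `DZ^{(S)}` of the image `centreAway W S := (centreFin W).map awayTfHom` in `T_f^{(S)}`, the
product `T_S × DZ^{(S)}` — pulled back along the split, `torusFinSplit⁻¹(univ ×ˢ DZ^{(S)})` — is a fundamental domain for
`centreFin W` in `T_f` (`isFundamentalDomain_preimage_prod_univ`): exactly L2-p2's `isFundamentalDomain_prodDomain`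
argument with `T_S` in place of `T_∞`, through `IsFundamentalDomain.preimage_of_equiv` (the pushforward of `ν_f = c (ν_S ⊗
ν^{(S)})` along the away part is `c ν_S(T_S) · ν^{(S)}`, absolutely continuous w.r.t. `ν^{(S)}`).  This is the product-domain
hypothesis of `suppMeasure_eq_mul` (SuppMeasureSplit) and of the main-term factorisation (x2's MainTermSplit) with
`DZS := univ`: the `S`-local integrals run over ALL of `T_S` (their integrands are supported in the compact level fibre).
The existence of `DZ^{(S)}` itself (typer-2's `exists_fundamentalDomain_of_discrete_of_central_cocompact` at `G := T_f^{(S)}`,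
`Γ := centreAway`) and its `hDZc`-type clause are the owner's (L2-p2) to instantiate — not claimed here.

Nothing here says anything about the status of the Hodge conjecture for CM abelian varieties, which is NOT proved
(HC_CM is NOT proved by anyone in this repository).
-/

set_option autoImplicit false
noncomputable section
namespace Summit.Ventures.HodgeRepro.Tier4.Line4
open Summit.Ventures.HodgeRepro.Tier4 Summit.Ventures.HodgeRepro.Tier4.Common
  Summit.Ventures.HodgeRepro.Tier4.Line1 NumberField IsDedekindDomain MeasureTheory
open scoped NumberField Classical NNReal ENNReal Pointwise

section ZSplit
variable {k : Type} [Field k] [NumberField k] (W : PlaneData k) (S : Set (HeightOneSpectrum (𝓞 k)))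

/-- The away part as a group homomorphism `T_f →* T_f^{(S)}`. -/
def awayTfHom : torusFin W →* torusFinAway W S :=
  (MonoidHom.snd (torusFinAt W S) (torusFinAway W S)).comp (torusFinSplit W S).toMonoidHom

/-- `awayTfHom` is `awayTf`. -/
theorem awayTfHom_apply (b : torusFin W) : awayTfHom W S b = awayTf W S b := rfl

/-- `awayTfHom` is continuous. -/
theorem continuous_awayTfHom : Continuous (awayTfHom W S) := continuous_awayTf W S

/-- **The image of the rational centre in the away torus** `T_f^{(S)}`. -/
def centreAway : Subgroup (torusFinAway W S) := (centreFin W).map (awayTfHom W S)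

/-- When the away part is injective on `centreFin`, `z ↦ z^{(S)}` is a bijection `centreFin ≃ centreAway`. -/
theorem bijective_awayTf_restrict (hinj : ∀ z ∈ centreFin W, awayTf W S z = 1 → z = 1) :
    Function.Bijective (fun z : centreFin W => (⟨awayTfHom W S z, ⟨z, z.2, rfl⟩⟩ : centreAway W S)) := by
  constructor
  · intro z z' hzz'
    have h : awayTfHom W S (z : torusFin W) = awayTfHom W S (z' : torusFin W) := congrArg Subtype.val hzz'
    have h1 : awayTfHom W S ((z : torusFin W) * (z' : torusFin W)⁻¹) = 1 := by
      have h2 : awayTfHom W S ((z : torusFin W) * (z' : torusFin W)⁻¹) * awayTfHom W S (z' : torusFin W) =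
          awayTfHom W S (z' : torusFin W) := by
        rw [← map_mul, inv_mul_cancel_right, h]
      exact mul_eq_right.1 h2
    exact Subtype.ext (mul_inv_eq_one.1 (hinj _ (mul_mem z.2 (inv_mem z'.2)) h1))
  · rintro ⟨y, z, hz, rfl⟩
    exact ⟨⟨z, hz⟩, rfl⟩

/-- The product set `T_S × DA`, pulled back along the split, is the preimage of `DA` under the away part. -/
theorem preimage_prod_univ_eq (DA : Set (torusFinAway W S)) :
    (torusFinSplit W S) ⁻¹' (Set.univ ×ˢ DA) = awayTfHom W S ⁻¹' DA := by
  ext b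
  simp only [Set.mem_preimage, Set.mem_prod, Set.mem_univ, true_and, torusFinSplit_apply]
  rfl

/-- **THE PRODUCT FUNDAMENTAL DOMAIN**: if `DA` is a fundamental domain for `centreAway` in `T_f^{(S)}` (for `ν^{(S)}`) and the
away part is injective on `centreFin`, then `T_S × DA` (pulled back along the split) is a fundamental domain for `centreFin`
in `T_f` (for `ν_f = c • (ν_S ⊗ ν^{(S)})`). -/
theorem isFundamentalDomain_preimage_prod_univ [MeasurableSpace (torusT W)] [BorelSpace (torusT W)]
    (νf : Measure (torusFin W)) [νf.IsHaarMeasure] (νS : Measure (torusFinAt W S)) [νS.IsHaarMeasure]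
    (νA : Measure (torusFinAway W S)) [νA.IsHaarMeasure] (c : ℝ≥0)
    (hc : νf = c • Measure.map (torusFinSplit W S).symm (νS.prod νA))
    (DA : Set (torusFinAway W S)) (hDA : IsFundamentalDomain (centreAway W S) DA νA)
    (hinj : ∀ z ∈ centreFin W, awayTf W S z = 1 → z = 1) :
    IsFundamentalDomain (centreFin W) ((torusFinSplit W S) ⁻¹' (Set.univ ×ˢ DA)) νf := by
  haveI : LocallyCompactSpace (torusFinAt W S) := locallyCompact_torusFinAt W S
  haveI : SecondCountableTopology (torusFinAt W S) := secondCountable_torusFinAt W S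
  haveI : LocallyCompactSpace (torusFinAway W S) := locallyCompact_torusFinAway W S
  haveI : SecondCountableTopology (torusFinAway W S) := secondCountable_torusFinAway W S
  haveI : IsLocallyFiniteMeasure νS := isLocallyFiniteMeasure_of_isFiniteMeasureOnCompacts
  haveI : SigmaFinite νS := sigmaFinite_of_locallyFinite
  haveI : IsLocallyFiniteMeasure νA := isLocallyFiniteMeasure_of_isFiniteMeasureOnCompacts
  haveI : SigmaFinite νA := sigmaFinite_of_locallyFinite
  have hmeas : Measurable (awayTfHom W S) := (continuous_awayTfHom W S).measurable
  have hsymm : Measurable (torusFinSplit W S).symm := (torusFinSplit W S).symm.toHomeomorph.measurable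
  rw [preimage_prod_univ_eq]
  let eqv := Equiv.ofBijective _ (bijective_awayTf_restrict W S hinj)
  refine hDA.preimage_of_equiv (f := awayTfHom W S) ⟨hmeas, ?_⟩ (e := eqv.symm) eqv.symm.bijective ?_
  · refine Measure.AbsolutelyContinuous.mk fun s hs hs0 => ?_
    rw [Measure.map_apply hmeas hs, hc, Measure.smul_apply, Measure.map_apply hsymm (hmeas hs)]
    have hset2 : (torusFinSplit W S).symm ⁻¹' (awayTfHom W S ⁻¹' s) = Set.univ ×ˢ s := by
      ext p
      simp only [Set.mem_preimage, Set.mem_prod, Set.mem_univ, true_and]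
      show awayTf W S ((torusFinSplit W S).symm p) ∈ s ↔ p.2 ∈ s
      have h := (torusFinSplit W S).apply_symm_apply p
      rw [torusFinSplit_apply] at h
      have h2 : awayTf W S ((torusFinSplit W S).symm p) = p.2 := (Prod.ext_iff.1 h).2
      rw [h2]
    rw [hset2, Measure.prod_prod, hs0, mul_zero, smul_zero]
  · intro g x
    show awayTfHom W S ((eqv.symm g : torusFin W) * x) = (g : torusFinAway W S) * awayTfHom W S x
    rw [map_mul]
    congr 1
    exact congrArg Subtype.val (eqv.apply_symm_apply g)

end ZSplit

section Injective
variable {k : Type} [Field k] [NumberField k] (W : PlaneData k) (S : Set (HeightOneSpectrum (𝓞 k)))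

/-- **The away part is injective on the rational centre** as soon as one finite place lies off `S`: a rational matrix whose
`w`-component is the identity is the identity (`algebraMap k k_w` is injective). -/
theorem eq_one_of_mem_centreFin_of_awayTf_eq_one (hS : ∃ w : HeightOneSpectrum (𝓞 k), w ∉ S) {z : torusFin W}
    (hz : z ∈ centreFin W) (h : awayTf W S z = 1) : z = 1 := by
  obtain ⟨w, hw⟩ := hS
  obtain ⟨ζ, hζ, rfl⟩ := hz
  obtain ⟨A, hA⟩ := exists_adMat_of_mem_rationalPoints W (rationalCentreT.mem_rationalPoints W hζ)
  -- the `w`-component of `ζ` is the identity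
  have h1 : GA.offPlacesPart W S (GA.ofFinPart W (ζ : GA W)) = 1 := by
    have := congrArg (fun x : torusFinAway W S => (((x : torusFin W) : torusT W) : GA W)) h
    simpa [coe_awayTf, coe_coe_finTfHom] using this
  have h2 : GA.finiteComponent W w (ζ : GA W) = 1 := by
    rw [← finiteComponent_ofFinPart, ← finiteComponent_offPlacesPart_of_notMem W S hw, h1, map_one]
  have h3 := (finiteComponent_eq_one_iff W w (ζ : GA W)).1 h2
  have hA1 : A = 1 := by
    ext i j
    have := h3 i j
    rw [hA] at this
    have hij : adComponentFin k w (adMat k A i j) = algebraMap k (w.adicCompletion k) (A i j) := rfl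
    rw [hij] at this
    apply (algebraMap k (w.adicCompletion k)).injective
    rw [this]
    by_cases hij' : i = j
    · subst hij'; simp
    · simp [Matrix.one_apply_ne hij']
  have hζ1 : ζ = 1 := by
    apply Subtype.ext
    apply Subtype.ext
    apply Units.ext
    show GA.mat W (ζ : GA W) = 1
    rw [hA, hA1, adMat_one]
  rw [hζ1, map_one]

/-- Some finite place of `k` lies off the places above a prime `p`: a place above a prime `q ≠ p`. -/
theorem exists_notMem_placesAbove {p : ℕ} (hp : p.Prime) :
    ∃ w : HeightOneSpectrum (𝓞 k), w ∉ placesAbove (k := k) p := by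
  obtain ⟨q, hpq, hq⟩ := Nat.exists_infinite_primes (p + 1)
  obtain ⟨w, hw⟩ := exists_heightOneSpectrum_natCast_mem (k := k) q hq
  refine ⟨w, fun hpw => ?_⟩
  have hne : p ≠ q := by omega
  have hcop : Nat.Coprime p q := (Nat.coprime_primes hp hq).2 hne
  have hcopZ : IsCoprime (p : ℤ) (q : ℤ) := Nat.isCoprime_iff_coprime.2 hcop
  have hcopO : IsCoprime (p : 𝓞 k) (q : 𝓞 k) := by
    have := hcopZ.map (Int.castRingHom (𝓞 k))
    simpa using this
  obtain ⟨a, b, hab⟩ := hcopO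
  have hpw' : (p : 𝓞 k) ∈ w.asIdeal := hpw
  have h1 : (1 : 𝓞 k) ∈ w.asIdeal := by
    rw [← hab]
    exact w.asIdeal.add_mem (w.asIdeal.mul_mem_left a hpw') (w.asIdeal.mul_mem_left b hw)
  exact w.isPrime.ne_top ((Ideal.eq_top_iff_one _).2 h1)

/-- **`hinj` for the split of record**: the away part is injective on the rational centre along `placesAbove p`. -/
theorem eq_one_of_mem_centreFin_of_awayTf_placesAbove_eq_one {p : ℕ} (hp : p.Prime) {z : torusFin W}
    (hz : z ∈ centreFin W) (h : awayTf W (placesAbove (k := k) p) z = 1) : z = 1 :=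
  eq_one_of_mem_centreFin_of_awayTf_eq_one W _ (exists_notMem_placesAbove (k := k) hp) hz h

end Injective

end Summit.Ventures.HodgeRepro.Tier4.Line4

end
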